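/-
Copyright: the b2b-balaban cell (near-miss cell 7), T⁴-continuum fan-out; row NE7b ROUND-2 swarm, seat
t4-ne7b-formalise-leaf-10 (gen 3; rows S6g′(f) + S1c of `t4/b2b-balaban-t4-ne7b-p1/LEAVES-NE7b.md`, owner's rulings
R-OWNER-22-12 (2), 22-18, 22-19).  Released under the licence of the surrounding project.
-/
import Summits.QuantumFields.BalabanUV.T4Continuum.Support.HistorySiblingEntropyRenew
import Summits.QuantumFields.BalabanUV.T4Continuum.Support.HistoryJoinsTag

/-!
# Sibling entropy bound — the CANONICAL LISTING: a recorded shape determines a canonically listed flat genealogy, so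
# the order display `InjPartsR` HOLDS on canonical members (rows S6g′(f) × S1c)

Summits-side support leaf of the T⁴-continuum cell (rung (B)+1 on a FINITE torus only; NOT infinite volume, NOT the
mass gap, NOT the Clay statement; NOT a proof of the spine estimate NE7b).  Row NE7b, route «COUNT»; sequel of
`HistorySiblingEntropyRenew`.  [folklore] structural induction over the lineage's own carriers; nothing is quoted from
print, nothing printed is asserted, no `[cite:]` tag, no `Prop` fact minted.

WHAT.  §1 chains: the cluster parts of a binary-merger chain of members closed at the chain's step are the members
in order (`snd_clusterParts_chainMerge`), the first part carries the all-`false` address (`head_clusterParts_chainMerge`),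
the chain's root address is that address followed by the head's when the head is oldest (`rootAddr_chainMerge`), so
**the host of a head-oldest chain is its head** (`part_hostIdx_chain`) and the non-host shapes are the tail's, in order
(`map_nonhost_chain`).  §2 **`Canon : Gen PEv → Prop`** — the normal form of a canonically written flat genealogy:
births `born (j,0,d) j`, renewals `renew G (s+1,1,0) s` (dated: the renewed component is of the previous step), chains
`chainMerge q₀ qs (fun _ => (s,2,0))` with `qs ≠ []`, members closed at `s`, head oldest, and the TAIL LISTED IN
RECORDED-SHAPE ORDER `(qs.map toShapeR).Pairwise (enc · ≤ enc ·)`.  §3 **`eq_of_toShapeR_eq : Canon G₁ → Canon G₂ →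
toShapeR G₁ = toShapeR G₂ → G₁ = G₂`** (parity of the recorded join step separates renewals `2s+1` from mergers
`2s+2`; sorted tails are fixed points of the sort, `List.mergeSort_of_pairwise`; members by induction on `gsize`) and
**`injPartsR_of_canon : Canon G → InjPartsR PEv.step PEv.fat G`**.  The pedigree side (`Canon (P.gen c)` from the
reading conventions `HeadOldest` + `TailSortedR` + `RenewDated`, and the END without order display) is the sequel
`HistorySiblingEntropyListing`.

HONEST SCOPE.  Combinatorics of OUR carriers only; which histories are written canonically is the reading's business
(row S1c file 1: the order-free realisation clause).  NE7b NOT proved.  HONEST DEPENDENCY (cell): continuum YM on T⁴ ⇐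
BetaPertH ∧ nine spine estimates (0/9 proved); BetaPertH ⇐ (D1) ∧ (D4) ∧ CAP+tail; G-an2-4 gates asym, D1 and
NE2/3/4.  This file changes none of it.
-/

open Finset
open Literature.MathematicalPhysics.QuantumFieldTheory.Balaban1983to89
open T4PersistenceDictionary T4PartnerMultiplicity T4BranchingRecordsGas
open Summit.QuantumFields.BalabanUV.T4Continuum.HistoryGen
open Summit.QuantumFields.BalabanUV.T4Continuum.HistoryJoins
open Summit.QuantumFields.BalabanUV.T4Continuum.HistoryJoinsAdm
open Summit.QuantumFields.BalabanUV.T4Continuum.HistoryJoinsTag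
open Summit.QuantumFields.BalabanUV.T4Continuum.HistorySiblingEntropyBound

namespace Summit.QuantumFields.BalabanUV.T4Continuum.HistorySiblingEntropyBridge

noncomputable section

open scoped Classical

/-! ## §1 The parts of a binary-merger chain -/

section Chain

variable {ε : Type*} (st : ε → ℕ)

/-- a chain over a non-empty list is a merger labelled by the list's last merger label [folklore] -/
theorem exists_chainMerge_eq_merge (l : ε) : ∀ (G : Gen ε) (Hs : List (Gen ε)), Hs ≠ [] →
    ∃ X Y, chainMerge G Hs (fun _ => l) = Gen.merge X Y l
  | G, [], h => (h rfl).elim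
  | G, [H], _ => ⟨G, H, rfl⟩
  | G, H :: H' :: Hs, _ => by
      rw [chainMerge_cons]
      exact exists_chainMerge_eq_merge l _ (H' :: Hs) (List.cons_ne_nil _ _)

/-- **THE CLUSTER PARTS OF A CHAIN** of members closed at the chain's step are the head's parts followed by the tail,
in order. [folklore] -/
theorem snd_clusterParts_chainMerge (s : ℕ) (l : ε) (hl : st l = s) : ∀ (G : Gen ε) (Hs : List (Gen ε)),
    (∀ H ∈ Hs, clusterParts st s H = [([], H)]) →
      (clusterParts st s (chainMerge G Hs fun _ => l)).map Prod.snd = (clusterParts st s G).map Prod.snd ++ Hs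
  | G, [], _ => by simp
  | G, H :: Hs, hH => by
      rw [chainMerge_cons, snd_clusterParts_chainMerge s l hl _ Hs fun H' h => hH H' (List.mem_cons_of_mem _ h),
        clusterParts_merge_of_eq st hl, hH H List.mem_cons_self]
      simp

/-- the FIRST cluster part of a chain: the head's first part, its address prefixed by one `false` per tail member
[folklore] -/
theorem head_clusterParts_chainMerge (s : ℕ) (l : ε) (hl : st l = s) : ∀ (G : Gen ε) (Hs : List (Gen ε)),
    (clusterParts st s (chainMerge G Hs fun _ => l))[0]? =
      ((clusterParts st s G)[0]?).map fun q => (List.replicate Hs.length false ++ q.1, q.2)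
  | G, [] => by simp
  | G, H :: Hs => by
      rw [chainMerge_cons, head_clusterParts_chainMerge s l hl _ Hs, clusterParts_merge_of_eq st hl]
      have hne : clusterParts st s G ≠ [] := by
        have := one_le_length_clusterParts st s G
        intro h; rw [h] at this; simp at this
      obtain ⟨q, qs, hq⟩ := List.exists_cons_of_ne_nil hne
      rw [hq]
      simp [List.replicate_succ']

/-- the root address of a head-oldest chain: one `false` per tail member, then the head's [folklore] -/
theorem rootAddr_chainMerge (t : ℕ → ε) : ∀ (G : Gen ε) (Hs : List (Gen ε)),
    (∀ H ∈ Hs, G.rootStep ≤ H.rootStep) →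
      rootAddr (chainMerge G Hs t) = List.replicate Hs.length false ++ rootAddr G
  | G, [], _ => by simp
  | G, H :: Hs, h => by
      rw [chainMerge_cons]
      have hle : G.rootStep ≤ H.rootStep := h H List.mem_cons_self
      have hGH : (Gen.merge G H (t 0)).rootStep = G.rootStep := by
        rw [Gen.rootStep_merge]; exact min_eq_left hle
      rw [rootAddr_chainMerge _ _ Hs (fun H' hH' => by rw [hGH]; exact h H' (List.mem_cons_of_mem _ hH'))]
      simp [rootAddr, hle, List.replicate_succ']

variable {st}

/-- **THE HOST OF A HEAD-OLDEST CHAIN IS ITS HEAD** (the head closed at the chain's step). [folklore] -/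
theorem part_hostIdx_chain {s : ℕ} {l : ε} (hl : st l = s) {q₀ : Gen ε} {qs : List (Gen ε)} {X Y : Gen ε}
    (hG : chainMerge q₀ qs (fun _ => l) = Gen.merge X Y l) (h₀ : clusterParts st s q₀ = [([], q₀)])
    (hold : ∀ q ∈ qs, q₀.rootStep ≤ q.rootStep) :
    ∃ h0 : 0 < npart st (Gen.merge X Y l), hostIdx st X Y l = ⟨0, h0⟩ ∧
      part st (Gen.merge X Y l) ⟨0, h0⟩ = (List.replicate qs.length false, q₀) := by
  have h0 : 0 < npart st (Gen.merge X Y l) := by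
    have := one_le_length_clusterParts st (st l) (Gen.merge X Y l)
    simp only [npart, jparts]; omega
  have hpart : part st (Gen.merge X Y l) ⟨0, h0⟩ = (List.replicate qs.length false, q₀) := by
    have hget : (jparts st (Gen.merge X Y l))[0]? = some (List.replicate qs.length false, q₀) := by
      simp only [jparts]
      rw [hl, ← hG, head_clusterParts_chainMerge st s l hl q₀ qs, h₀]
      simp
    unfold part
    rw [List.get_eq_getElem]
    exact (List.getElem_eq_iff (l := jparts st (Gen.merge X Y l)) h0).2 hget
  refine ⟨h0, ?_, hpart⟩
  symm
  refine eq_hostIdx_of_prefix st X Y l (r := rootAddr q₀) ?_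
  rw [hpart, ← hG, rootAddr_chainMerge _ q₀ qs hold]

/-- under `hostIdx = 0` the non-host parts are the parts after the first, in order [folklore] -/
theorem map_nonhost_of_hostIdx_eq_zero {X Y : Gen ε} {e : ε} {β : Type*} (h0 : 0 < npart st (Gen.merge X Y e))
    (hh : hostIdx st X Y e = ⟨0, h0⟩) (f : List Bool × Gen ε → β) :
    (nonhost st X Y e).map (fun i => f (part st (Gen.merge X Y e) i)) = ((jparts st (Gen.merge X Y e)).map f).tail := by
  have hfr : ∀ n (g : Fin n → β) (hn : 0 < n),
      ((List.finRange n).filter fun i => i ≠ ⟨0, hn⟩).map g = ((List.finRange n).map g).tail := by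
    intro n g hn
    obtain ⟨m, rfl⟩ : ∃ m, n = m + 1 := ⟨n - 1, by omega⟩
    rw [List.finRange_succ, List.filter_cons_of_neg (by simp), List.map_cons, List.tail_cons,
      List.filter_eq_self.2 (by intro i hi; obtain ⟨j, _, rfl⟩ := List.mem_map.1 hi; simp [Fin.succ_ne_zero])]
  unfold nonhost
  rw [hh, hfr _ _ h0]
  congr 1
  apply List.ext_getElem (by simp [npart])
  intro i h1 h2
  simp [part]

/-- **THE NON-HOST SHAPES OF A HEAD-OLDEST CHAIN ARE THE TAIL'S, IN ORDER.** [folklore] -/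
theorem map_nonhost_chain {s : ℕ} {l : ε} (hl : st l = s) {q₀ : Gen ε} {qs : List (Gen ε)} {X Y : Gen ε}
    (hG : chainMerge q₀ qs (fun _ => l) = Gen.merge X Y l) (h₀ : clusterParts st s q₀ = [([], q₀)])
    (hqs : ∀ q ∈ qs, clusterParts st s q = [([], q)]) (hold : ∀ q ∈ qs, q₀.rootStep ≤ q.rootStep) {β : Type*}
    (g : Gen ε → β) :
    (nonhost st X Y l).map (fun i => g (part st (Gen.merge X Y l) i).2) = qs.map g := by
  obtain ⟨h0, hh, -⟩ := part_hostIdx_chain hl hG h₀ hold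
  rw [map_nonhost_of_hostIdx_eq_zero h0 hh (fun q => g q.2)]
  have hsnd : (jparts st (Gen.merge X Y l)).map Prod.snd = q₀ :: qs := by
    simp only [jparts]
    rw [hl, ← hG, snd_clusterParts_chainMerge st s l hl q₀ qs hqs, h₀]
    simp
  have : (jparts st (Gen.merge X Y l)).map (fun q => g q.2) = (q₀ :: qs).map g := by
    rw [← hsnd, List.map_map]; rfl
  rw [this, List.map_cons, List.tail_cons]

/-- the parts of a chain (as sub-structures) are the head and the tail [folklore] -/
theorem mem_cons_of_part_chain {s : ℕ} {l : ε} (hl : st l = s) {q₀ : Gen ε} {qs : List (Gen ε)} {X Y : Gen ε}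
    (hG : chainMerge q₀ qs (fun _ => l) = Gen.merge X Y l) (h₀ : clusterParts st s q₀ = [([], q₀)])
    (hqs : ∀ q ∈ qs, clusterParts st s q = [([], q)]) (i : Fin (npart st (Gen.merge X Y l))) :
    (part st (Gen.merge X Y l) i).2 ∈ q₀ :: qs := by
  have hsnd : (jparts st (Gen.merge X Y l)).map Prod.snd = q₀ :: qs := by
    simp only [jparts]
    rw [hl, ← hG, snd_clusterParts_chainMerge st s l hl q₀ qs hqs, h₀]
    simp
  rw [← hsnd]
  exact List.mem_map.2 ⟨_, part_mem st _ i, rfl⟩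

/-- a tail member of a chain is a proper sub-structure [folklore] -/
theorem gsize_lt_chain_of_mem {l : ε} : ∀ (q₀ : Gen ε) (qs : List (Gen ε)) (q : Gen ε), q ∈ q₀ :: qs → qs ≠ [] →
    gsize q < gsize (chainMerge q₀ qs fun _ => l)
  | q₀, [], q, _, h => (h rfl).elim
  | q₀, H :: Hs, q, hq, _ => by
      rw [chainMerge_cons]
      have hmono : ∀ (G : Gen ε) (Gs : List (Gen ε)), gsize G ≤ gsize (chainMerge G Gs fun _ => l) := by
        intro G Gs
        induction Gs generalizing G with
        | nil => simp
        | cons K Ks ih => rw [chainMerge_cons]; exact le_trans (by simp [gsize]; omega) (ih _)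
      have h1 := hmono (Gen.merge q₀ H l) Hs
      rcases List.mem_cons.1 hq with rfl | hq
      · simp [gsize] at h1 ⊢; omega
      rcases List.mem_cons.1 hq with rfl | hq
      · simp [gsize] at h1 ⊢; omega
      · exact gsize_lt_chain_of_mem (Gen.merge q₀ H l) Hs q (List.mem_cons_of_mem _ hq) (by rintro rfl; simp at hq)

end Chain

/-! ## §2 The normal form of a canonically written flat genealogy -/

/-- the canonical merger label at step `s` [folklore] -/
def merL (s : ℕ) : ℕ → PEv := fun _ => ((s, 2, 0) : PEv)

/-- **CANONICALLY WRITTEN FLAT GENEALOGIES**: flat births; DATED flat renewals; binary-merger chains at one step with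
members closed at that step, the head oldest and THE TAIL LISTED IN RECORDED-SHAPE ORDER. [folklore] -/
inductive Canon : Gen PEv → Prop
  | born (j d : ℕ) : Canon (Gen.born ((j, 0, d) : PEv) j)
  | renew (G : Gen PEv) (s : ℕ) (hG : Canon G) : Canon (Gen.renew G ((s + 1, 1, 0) : PEv) s)
  | chain (s : ℕ) (q₀ : Gen PEv) (qs : List (Gen PEv)) (hne : qs ≠ []) (h₀ : Canon q₀) (hqs : ∀ q ∈ qs, Canon q)
      (hc₀ : clusterParts PEv.step s q₀ = [([], q₀)]) (hc : ∀ q ∈ qs, clusterParts PEv.step s q = [([], q)])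
      (hold : ∀ q ∈ qs, q₀.rootStep ≤ q.rootStep)
      (hsort : (qs.map (toShapeR PEv.step PEv.fat)).Pairwise fun x y => enc x ≤ enc y) :
      Canon (chainMerge q₀ qs (merL s))

/-- a sorted list of shapes is a fixed point of the canonical sort [folklore] -/
theorem sortS_eq_of_pairwise {l : List Shape} (h : l.Pairwise fun x y => enc x ≤ enc y) : sortS l = l :=
  List.mergeSort_of_pairwise (h.imp fun hab => by simpa [encLE] using hab)

/-- lists with equal images under a map injective across them are equal [folklore] -/
theorem list_eq_of_map_eq {β γ : Type*} (f : β → γ) : ∀ (l l' : List β),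
    (∀ x ∈ l, ∀ y ∈ l', f x = f y → x = y) → l.map f = l'.map f → l = l'
  | [], [], _, _ => rfl
  | [], _ :: _, _, h => by simp at h
  | _ :: _, [], _, h => by simp at h
  | x :: l, y :: l', hinj, h => by
      simp only [List.map_cons, List.cons.injEq] at h
      rw [hinj x List.mem_cons_self y List.mem_cons_self h.1,
        list_eq_of_map_eq f l l' (fun a ha b hb => hinj a (List.mem_cons_of_mem _ ha) b (List.mem_cons_of_mem _ hb)) h.2]

/-! ## §3 The recorded shape determines the canonical genealogy -/

/-- the recorded shape of a canonical chain: host = head, non-host shapes = the tail's (already sorted) [folklore] -/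
theorem toShapeR_chain {s : ℕ} {q₀ : Gen PEv} {qs : List (Gen PEv)} {X Y : Gen PEv}
    (hG : chainMerge q₀ qs (merL s) = Gen.merge X Y ((s, 2, 0) : PEv)) (hc₀ : clusterParts PEv.step s q₀ = [([], q₀)])
    (hc : ∀ q ∈ qs, clusterParts PEv.step s q = [([], q)]) (hold : ∀ q ∈ qs, q₀.rootStep ≤ q.rootStep)
    (hsort : (qs.map (toShapeR PEv.step PEv.fat)).Pairwise fun x y => enc x ≤ enc y) :
    toShapeR PEv.step PEv.fat (chainMerge q₀ qs (merL s)) =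
      .join (2 * s + 2) (toShapeR PEv.step PEv.fat q₀) (ofList (qs.map (toShapeR PEv.step PEv.fat))) := by
  have hl : PEv.step ((s, 2, 0) : PEv) = s := rfl
  obtain ⟨h0, hh, hpart⟩ := part_hostIdx_chain hl hG hc₀ hold
  rw [hG, toShapeR_merge, hh, hpart, map_nonhost_chain hl hG hc₀ hc hold, sortS_eq_of_pairwise hsort]
  rfl

/-- **THE RECORDED SHAPE DETERMINES A CANONICALLY WRITTEN FLAT GENEALOGY.** [folklore] -/
theorem eq_of_toShapeR_eq {G₁ G₂ : Gen PEv} (h1 : Canon G₁) (h2 : Canon G₂)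
    (he : toShapeR PEv.step PEv.fat G₁ = toShapeR PEv.step PEv.fat G₂) : G₁ = G₂ := by
  suffices h : ∀ n, ∀ (G₁ G₂ : Gen PEv), gsize G₁ ≤ n → Canon G₁ → Canon G₂ →
      toShapeR PEv.step PEv.fat G₁ = toShapeR PEv.step PEv.fat G₂ → G₁ = G₂ from
    h _ _ _ le_rfl h1 h2 he
  intro n
  induction n with
  | zero => intro G₁ G₂ hn; cases G₁ <;> simp [gsize] at hn
  | succ n ih =>
      intro G₁ G₂ hn h1 h2 he
      rcases h1 with ⟨j, d⟩ | ⟨G, s, hG⟩ | ⟨s, q₀, qs, hne, hq₀, hqs, hc₀, hc, hold, hsort⟩ <;>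
        rcases h2 with ⟨j', d'⟩ | ⟨G', s', hG'⟩ | ⟨s', q₀', qs', hne', hq₀', hqs', hc₀', hc', hold', hsort'⟩
      · -- born ∕ born
        simp only [toShapeR_born, PEv.fat_mk, Shape.atom.injEq] at he
        obtain ⟨hj, hd⟩ := he
        have : j = j' := by omega
        subst this; subst hd; rfl
      · simp [toShapeR_born, toShapeR_renew] at he
      · obtain ⟨X, Y, hXY⟩ := exists_chainMerge_eq_merge ((s', 2, 0) : PEv) q₀' qs' hne'
        rw [show merL s' = fun _ => ((s', 2, 0) : PEv) from rfl] at he ⊢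
        rw [hXY, toShapeR_merge] at he
        simp at he
      · simp [toShapeR_born, toShapeR_renew] at he
      · -- renew ∕ renew
        rw [toShapeR_renew, toShapeR_renew] at he
        simp only [PEv.step_mk, Shape.join.injEq] at he
        obtain ⟨hs, hh, -⟩ := he
        have hss : s = s' := by omega
        subst hss
        rw [ih _ _ (by simp [gsize] at hn; omega) hG hG' hh]
      · obtain ⟨X, Y, hXY⟩ := exists_chainMerge_eq_merge ((s', 2, 0) : PEv) q₀' qs' hne'
        rw [show merL s' = fun _ => ((s', 2, 0) : PEv) from rfl] at he ⊢
        rw [hXY, toShapeR_merge, toShapeR_renew] at he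
        simp only [PEv.step_mk, Shape.join.injEq] at he
        omega
      · obtain ⟨X, Y, hXY⟩ := exists_chainMerge_eq_merge ((s, 2, 0) : PEv) q₀ qs hne
        rw [show merL s = fun _ => ((s, 2, 0) : PEv) from rfl] at he ⊢
        rw [hXY, toShapeR_merge] at he
        simp at he
      · obtain ⟨X, Y, hXY⟩ := exists_chainMerge_eq_merge ((s, 2, 0) : PEv) q₀ qs hne
        rw [show merL s = fun _ => ((s, 2, 0) : PEv) from rfl] at he ⊢
        rw [hXY, toShapeR_merge, toShapeR_renew] at he
        simp only [PEv.step_mk, Shape.join.injEq] at he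
        omega
      · -- chain ∕ chain
        obtain ⟨X, Y, hXY⟩ := exists_chainMerge_eq_merge ((s, 2, 0) : PEv) q₀ qs hne
        obtain ⟨X', Y', hXY'⟩ := exists_chainMerge_eq_merge ((s', 2, 0) : PEv) q₀' qs' hne'
        rw [toShapeR_chain hXY hc₀ hc hold hsort, toShapeR_chain hXY' hc₀' hc' hold' hsort'] at he
        simp only [Shape.join.injEq] at he
        obtain ⟨hs, hhead, htail⟩ := he
        have hss : s = s' := by omega
        subst hss
        have htail' : qs.map (toShapeR PEv.step PEv.fat) = qs'.map (toShapeR PEv.step PEv.fat) := by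
          have := congrArg Parts.toList htail
          simpa using this
        have hlt : ∀ q ∈ q₀ :: qs, gsize q ≤ n := fun q hq => by
          have := gsize_lt_chain_of_mem (l := ((s, 2, 0) : PEv)) q₀ qs q hq hne
          rw [show (fun _ => ((s, 2, 0) : PEv)) = merL s from rfl] at this
          omega
        have h0 : q₀ = q₀' := ih _ _ (hlt q₀ List.mem_cons_self) hq₀ hq₀' hhead
        have ht : qs = qs' :=
          list_eq_of_map_eq _ qs qs' (fun x hx y hy hxy =>
            ih _ _ (hlt x (List.mem_cons_of_mem _ hx)) (hqs x hx) (hqs' y hy) hxy) htail'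
        subst h0; subst ht; rfl

/-- **THE ORDER DISPLAY HOLDS ON CANONICALLY WRITTEN FLAT GENEALOGIES.** [folklore] -/
theorem injPartsR_of_canon {G : Gen PEv} (hG : Canon G) : InjPartsR PEv.step PEv.fat G := by
  suffices h : ∀ n, ∀ (G : Gen PEv), gsize G ≤ n → Canon G → InjPartsR PEv.step PEv.fat G from h _ _ le_rfl hG
  intro n
  induction n with
  | zero => intro G hn; cases G <;> simp [gsize] at hn
  | succ n ih =>
      intro G hn hG
      rcases hG with ⟨j, d⟩ | ⟨G, s, hG⟩ | ⟨s, q₀, qs, hne, hq₀, hqs, hc₀, hc, hold, hsort⟩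
      · rw [InjPartsR]; trivial
      · rw [InjPartsR]; exact ih _ (by simp [gsize] at hn; omega) hG
      · obtain ⟨X, Y, hXY⟩ := exists_chainMerge_eq_merge ((s, 2, 0) : PEv) q₀ qs hne
        have hmem : ∀ i, (part PEv.step (Gen.merge X Y ((s, 2, 0) : PEv)) i).2 ∈ q₀ :: qs :=
          mem_cons_of_part_chain (st := PEv.step) rfl hXY hc₀ hc
        have hcan : ∀ q ∈ q₀ :: qs, Canon q := fun q hq => by
          rcases List.mem_cons.1 hq with rfl | hq
          · exact hq₀
          · exact hqs q hq
        have hlt : ∀ q ∈ q₀ :: qs, gsize q ≤ n := fun q hq => by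
          have := gsize_lt_chain_of_mem (l := ((s, 2, 0) : PEv)) q₀ qs q hq hne
          rw [show (fun _ => ((s, 2, 0) : PEv)) = merL s from rfl] at this
          omega
        rw [show merL s = fun _ => ((s, 2, 0) : PEv) from rfl, hXY, InjPartsR]
        exact ⟨fun i => ih _ (hlt _ (hmem i)) (hcan _ (hmem i)),
          fun i j _ _ hij => eq_of_toShapeR_eq (hcan _ (hmem i)) (hcan _ (hmem j)) hij⟩

end

end Summit.QuantumFields.BalabanUV.T4Continuum.HistorySiblingEntropyBridge
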